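import Mathlib.Analysis.InnerProductSpace.PiL2
import HarnessLib

/-!
# Multiple twinning never returns: the 3-adic obstruction (abstract form)

HONEST FRAMING. Part of the venture `Summits/Ventures/Crystal3D` (cell `crystal3d-full`), helper for the
crux `CoaxialWallLaw` (stmt-Ventures-19481) of `route-Ventures-StickyWulffConstant`, REGISTERED line
`WallLedgerF` (planner cf-p1 gen 16), open stub `stub_coaxialTwoSlabAdhesion` (general fillings).  Brick N of
the v2 (NET) line automaton (memo F-NET-AUTOMATON-v2, evidence on the crux item): the classes of the v2
automaton are reduced words in the `{111}` mirrors, and the capacity bound at the top window needs «a reduced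
word of mirrors that is not empty never maps the lattice onto itself» (no `Σ3ⁿ` chain closes up, `Σ3ⁿ ≠ Σ1`).
This file is the ABSTRACT algebra of that fact; the transport to frames/words is the next brick.  Rung credit
only; F-C1 not moved.

SETTING.  `M ⊆ ℝ³` an additive subgroup on which squared norms are integers (the fcc lattice with unit
nearest-neighbour distance).  An AXIS is a vector `t ∈ M` with `⟪w, t⟫ ∈ ℤ` for all `w ∈ M` (for fcc:
`t = √6 · m`, `m` a `{111}` unit normal — three layers); the `{111}` mirror is `R_t v = v − (⟪v,t⟫/3) t`
(inlined as `v ↦ v − (⟪v,t⟫/3) • t`; a chain is `List.foldr` of it, outermost axis first).  Consecutive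
axes of a chain meet at `⟪tᵢ, tᵢ₊₁⟫ = ±2` (distinct `⟨111⟩` axes: `6 · (±1/3)`), a `List.IsChain` condition.
No new definitions are introduced (the v2 automaton's Defs file will name these objects).

**Theorem (`mirrorChain_repr`).**  For a chain `t₁, …, t_k` (`k ≥ 1`) and `v ∈ M`:
`3^k · (R_{t₁} ∘ ⋯ ∘ R_{t_k}) v = c · t₁ + 3 · w` with `w ∈ M`, `c ∈ ℤ`, `c² = 4^{k−1} ⟪v, t_k⟫²`.
**Theorem (`mirrorChain_not_mem`).**  If moreover `‖t₁‖² = 6` and `⟪u, t_k⟫ = ±2` (`u ∈ M`, e.g. a far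
slot of the innermost mirror), then `(R_{t₁} ∘ ⋯ ∘ R_{t_k}) u ∉ M`: otherwise `c · t₁ ∈ 3M` with `c² = 4^k`,
and `‖c t₁‖²/9 = 2·4^k/3` is not an integer.

WHAT THIS IS NOT: not the stub; the frame/word transport (`F_w(Λ₀) ≠ F_{w'}(Λ₀)` for reduced `w ≠ w'`) is
the next brick; F-C1 not moved.
-/

noncomputable section

namespace Summit.Ventures.Crystal3D.Theorems

open scoped InnerProductSpace

/-- `3 · R_t x = 3 x − ⟪x, t⟫ t` for the `{111}` mirror `R_t x = x − (⟪x,t⟫/3) t`. -/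
theorem three_smul_triMirror (t x : EuclideanSpace ℝ (Fin 3)) :
    (3 : ℝ) • (x - (⟪x, t⟫_ℝ / 3) • t) = (3 : ℝ) • x - ⟪x, t⟫_ℝ • t := by
  rw [smul_sub, smul_smul]
  congr 2
  ring

/-- **The 3-adic normal form of a mirror chain.**  See the module docstring. -/
theorem mirrorChain_repr (M : Set (EuclideanSpace ℝ (Fin 3)))
    (hadd : ∀ x ∈ M, ∀ y ∈ M, x + y ∈ M) (hzs : ∀ (z : ℤ), ∀ x ∈ M, (z : ℝ) • x ∈ M) :
    ∀ (ts : List (EuclideanSpace ℝ (Fin 3))) (tl : EuclideanSpace ℝ (Fin 3)),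
      (∀ t ∈ ts ++ [tl], t ∈ M ∧ ∀ w ∈ M, ∃ z : ℤ, ⟪w, t⟫_ℝ = z) →
      List.IsChain (fun t s => ⟪t, s⟫_ℝ = 2 ∨ ⟪t, s⟫_ℝ = -2) (ts ++ [tl]) →
      ∀ v ∈ M, ∃ (c : ℤ) (w : EuclideanSpace ℝ (Fin 3)), w ∈ M ∧
        (3 : ℝ) ^ (ts.length + 1) •
            (ts ++ [tl]).foldr (fun t (x : EuclideanSpace ℝ (Fin 3)) => x - (⟪x, t⟫_ℝ / 3) • t) v =
          (c : ℝ) • (ts ++ [tl]).headD tl + (3 : ℝ) • w ∧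
        (c : ℝ) ^ 2 = 4 ^ ts.length * ⟪v, tl⟫_ℝ ^ 2 := by
  intro ts
  induction ts with
  | nil =>
    intro tl haxes _ v hv
    obtain ⟨-, hint⟩ := haxes tl (by simp)
    obtain ⟨z, hz⟩ := hint v hv
    refine ⟨-z, v, hv, ?_, ?_⟩
    · simp only [List.nil_append, List.length_nil, zero_add, pow_one, List.foldr_cons, List.foldr_nil,
        List.headD_cons]
      rw [three_smul_triMirror, hz]
      push_cast
      rw [neg_smul]
      abel
    · rw [List.length_nil, pow_zero, one_mul, hz]
      push_cast
      ring
  | cons t ts ih =>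
    intro tl haxes hchain v hv
    -- the inner chain
    have haxes' : ∀ s ∈ ts ++ [tl], s ∈ M ∧ ∀ w ∈ M, ∃ z : ℤ, ⟪w, s⟫_ℝ = z :=
      fun s hs => haxes s (by simp only [List.cons_append, List.mem_cons]; exact Or.inr hs)
    have ht : t ∈ M ∧ ∀ w ∈ M, ∃ z : ℤ, ⟪w, t⟫_ℝ = z := haxes t (by simp)
    -- adjacency of `t` with the outermost axis of the inner chain, and the inner chain condition
    have hadj : (⟪t, (ts ++ [tl]).headD tl⟫_ℝ = 2 ∨ ⟪t, (ts ++ [tl]).headD tl⟫_ℝ = -2) ∧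
        List.IsChain (fun t s => ⟪t, s⟫_ℝ = 2 ∨ ⟪t, s⟫_ℝ = -2) (ts ++ [tl]) := by
      cases ts with
      | nil => simpa [List.isChain_cons_cons] using hchain
      | cons s rest => simpa [List.isChain_cons_cons] using hchain
    obtain ⟨c', w', hw', hrepr, hsq⟩ := ih tl haxes' hadj.2 v hv
    -- the pairing of `w'` with `t` is an integer
    obtain ⟨z, hz⟩ := ht.2 w' hw'
    have hfirst : ((t :: ts) ++ [tl]).headD tl = t := rfl
    -- inner product of the inner first axis with `t`: ±2, as an integer `e`
    obtain ⟨e, he, he2⟩ : ∃ e : ℤ, ⟪(ts ++ [tl]).headD tl, t⟫_ℝ = e ∧ (e : ℝ) ^ 2 = 4 := by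
      rcases hadj.1 with h | h
      · exact ⟨2, by rw [real_inner_comm]; exact_mod_cast h, by norm_num⟩
      · exact ⟨-2, by rw [real_inner_comm]; exact_mod_cast h, by norm_num⟩
    refine ⟨-(c' * e), (c' : ℝ) • (ts ++ [tl]).headD tl + (3 : ℝ) • w' - (z : ℝ) • t, ?_, ?_, ?_⟩
    · -- membership in `M`
      have h1 : (c' : ℝ) • (ts ++ [tl]).headD tl ∈ M := by
        refine hzs c' _ ?_
        cases ts with
        | nil => exact (haxes' tl (by simp)).1
        | cons s rest => exact (haxes' s (by simp)).1
      have h2 : ((3 : ℤ) : ℝ) • w' ∈ M := hzs 3 w' hw'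
      have h3 : ((-z : ℤ) : ℝ) • t ∈ M := hzs (-z) t ht.1
      have := hadd _ (hadd _ h1 _ h2) _ h3
      push_cast at this
      rw [neg_smul, ← sub_eq_add_neg] at this
      exact this
    · -- the representation
      have hin : (3 : ℝ) ^ (ts.length + 1) *
          ⟪(ts ++ [tl]).foldr (fun t (x : EuclideanSpace ℝ (Fin 3)) => x - (⟪x, t⟫_ℝ / 3) • t) v, t⟫_ℝ =
          c' * e + 3 * z := by
        rw [← real_inner_smul_left, hrepr, inner_add_left, real_inner_smul_left, real_inner_smul_left, he, hz]
      rw [hfirst, List.cons_append, List.foldr_cons, List.length_cons, pow_succ (3 : ℝ) (ts.length + 1), mul_smul,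
        three_smul_triMirror, smul_sub,
        smul_comm ((3 : ℝ) ^ (ts.length + 1)) (3 : ℝ)
          ((ts ++ [tl]).foldr (fun t (x : EuclideanSpace ℝ (Fin 3)) => x - (⟪x, t⟫_ℝ / 3) • t) v),
        hrepr, smul_smul, hin]
      push_cast
      module
    · push_cast
      rw [neg_sq, mul_pow, hsq, he2, List.length_cons, pow_succ]
      ring

/-- **Multiple twinning never returns (abstract 3-adic form).**  See the module docstring. -/
theorem mirrorChain_not_mem (M : Set (EuclideanSpace ℝ (Fin 3)))
    (hadd : ∀ x ∈ M, ∀ y ∈ M, x + y ∈ M) (hzs : ∀ (z : ℤ), ∀ x ∈ M, (z : ℝ) • x ∈ M)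
    (hint : ∀ w ∈ M, ∃ z : ℤ, ‖w‖ ^ 2 = z)
    (ts : List (EuclideanSpace ℝ (Fin 3))) (tl : EuclideanSpace ℝ (Fin 3))
    (haxes : ∀ t ∈ ts ++ [tl], t ∈ M ∧ ∀ w ∈ M, ∃ z : ℤ, ⟪w, t⟫_ℝ = z)
    (hchain : List.IsChain (fun t s => ⟪t, s⟫_ℝ = 2 ∨ ⟪t, s⟫_ℝ = -2) (ts ++ [tl]))
    (hnorm : ‖(ts ++ [tl]).headD tl‖ ^ 2 = 6)
    {u : EuclideanSpace ℝ (Fin 3)} (hu : u ∈ M) (hut : ⟪u, tl⟫_ℝ = 2 ∨ ⟪u, tl⟫_ℝ = -2) :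
    (ts ++ [tl]).foldr (fun t (x : EuclideanSpace ℝ (Fin 3)) => x - (⟪x, t⟫_ℝ / 3) • t) u ∉ M := by
  intro hmem
  obtain ⟨c, w, hw, hrepr, hsq⟩ := mirrorChain_repr M hadd hzs ts tl haxes hchain u hu
  have hc2 : (c : ℝ) ^ 2 = 4 ^ (ts.length + 1) := by
    rw [hsq, pow_succ (4 : ℝ) ts.length]
    rcases hut with h | h <;> rw [h] <;> norm_num
  -- `c • t₁ = 3 • w'` with `w' ∈ M`
  set w' : EuclideanSpace ℝ (Fin 3) := ((3 ^ ts.length : ℤ) : ℝ) •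
      (ts ++ [tl]).foldr (fun t (x : EuclideanSpace ℝ (Fin 3)) => x - (⟪x, t⟫_ℝ / 3) • t) u +
    ((-1 : ℤ) : ℝ) • w with hw'
  have hw'M : w' ∈ M := hadd _ (hzs _ _ hmem) _ (hzs _ _ hw)
  have hct : (c : ℝ) • (ts ++ [tl]).headD tl = (3 : ℝ) • w' := by
    rw [hw']
    push_cast
    rw [smul_add, smul_smul, ← pow_succ', neg_one_smul, smul_neg, hrepr]
    abel
  -- norms: `6 c² = 9 ‖w'‖²`
  obtain ⟨z, hz⟩ := hint w' hw'M
  have hn : (c : ℝ) ^ 2 * 6 = 9 * z := by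
    have h1 : ‖(c : ℝ) • (ts ++ [tl]).headD tl‖ ^ 2 = ‖(3 : ℝ) • w'‖ ^ 2 := by rw [hct]
    rw [norm_smul, norm_smul, mul_pow, mul_pow, hnorm, hz, Real.norm_eq_abs, Real.norm_eq_abs, sq_abs,
      sq_abs] at h1
    linarith
  rw [hc2] at hn
  -- `2 · 4^(k) = 3 z` is impossible mod 3
  have hint' : (2 : ℤ) * 4 ^ (ts.length + 1) = 3 * z := by
    have : ((2 : ℤ) * 4 ^ (ts.length + 1) : ℝ) = (3 * z : ℤ) := by push_cast; linarith
    exact_mod_cast this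
  have hmod : (2 : ℤ) * 4 ^ (ts.length + 1) ≡ 2 [ZMOD 3] := by
    have h4 : (4 : ℤ) ^ (ts.length + 1) ≡ 1 [ZMOD 3] := by
      have := Int.ModEq.pow (ts.length + 1) (show (4 : ℤ) ≡ 1 [ZMOD 3] by decide)
      simpa using this
    simpa using Int.ModEq.mul_left 2 h4
  rw [hint'] at hmod
  have : (3 * z) % 3 = 2 % 3 := hmod
  omega

end Summit.Ventures.Crystal3D.Theorems

end
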